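import Mathlib
import Literature.Probability.Percolation.SharpnessDCTProofs
import Literature.Probability.Percolation.HarrisLocal
import Literature.Probability.Percolation.CriticalOneArmBKLowerBound
import Literature.Probability.Percolation.LocalLimitConnections
import Literature.Probability.Percolation.CriticalContinuity
import HarnessLib

/-!
# Route `PercHyperscalingGluing`, crux `BoxGluing` (stmt-CriticalPhenomena-4643): stub `stub_pairFKG`

Helper file (`--supports stmt-CriticalPhenomena-4643`) for the line `Lines/birth.lean` (lead reshape
r2) of the crux `Summit.CriticalPhenomena.PercolationContinuityZ3.Theses.PercHyperscalingGluing.BoxGluing`.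
It proves the first of the four registered stubs of the composition `BoxGluing_of`, the
**Harris–FKG pair bound**: for bond percolation on `ℤ³` at `p_c = criticalProbI 3` and every `n`,

`|Λ_n| · P_{p_c}(0 ↔ ∂Λ_n)² ≤ Σ_{x ∈ Λ_n} P_{p_c}(A_0 ∩ A_x)`,

where `Λ_n = box 3 n`, `P(0 ↔ ∂Λ_n) = P.real (siteToBoundary 3 n)` and
`A_y = DCT16.armEvent y n = {y ↔ y + ∂Λ_n inside y + Λ_n}` is the translated one-arm event.

Proof: `A_0` and `A_x` are increasing (`isUpperSet_armEvent_translate`) local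
(`isLocalEvent_armEvent`) events, so Harris's inequality for local increasing events
(`harris_fkg_local`) gives `P(A_0) P(A_x) ≤ P(A_0 ∩ A_x)`; by translation invariance
(`DCT16.real_armEvent`) `P(A_y) = P(0 ↔ ∂Λ_n)` for every `y`, so each summand on the right is at
least `P(0 ↔ ∂Λ_n)²`, and summing the constant over `x ∈ Λ_n` gives the claim (`Finset.sum_const`).
No side condition on `n`. Pure proof file, no definitions.
-/

noncomputable section

namespace Summit.CriticalPhenomena.PercolationContinuityZ3.Theorems

open MeasureTheory ProbabilityTheory
open Literature.Probability.Percolation Literature.Probability.LatticeModels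

/-- **Harris–FKG for a pair of translated arm events.** For bond percolation on `ℤ^d` at any
parameter `p`, any sites `v w` and any `n`,
`P_p(0 ↔ ∂Λ_n)² ≤ P_p(A_v ∩ A_w)` with `A_y = DCT16.armEvent y n`: both arm events are increasing
and local, so Harris's inequality applies, and each has probability `P_p(0 ↔ ∂Λ_n)` by translation
invariance. [folklore] -/
theorem PairFKG.real_siteToBoundary_sq_le_real_armEvent_inter {d : ℕ} (p : unitInterval)
    (v w : Site d) (n : ℕ) :
    (bondPercolation (zdGraph d) p).real (siteToBoundary d n) ^ 2 ≤
      (bondPercolation (zdGraph d) p).real (DCT16.armEvent v n ∩ DCT16.armEvent w n) := by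
  have hH := harris_fkg_local (zdGraph d) p (isUpperSet_armEvent_translate v n)
    (isUpperSet_armEvent_translate w n) (isLocalEvent_armEvent v n) (isLocalEvent_armEvent w n)
  rw [DCT16.real_armEvent, DCT16.real_armEvent] at hH
  rw [sq]
  exact hH

/-- **Stub `stub_pairFKG` of the line `Lines/birth.lean` (crux `BoxGluing`, reshape r2) —
HARRIS–FKG PAIR BOUND.** For bond percolation on `ℤ³` at `p_c = criticalProbI 3` and every `n`,
`|Λ_n| · P_{p_c}(0 ↔ ∂Λ_n)² ≤ Σ_{x ∈ Λ_n} P_{p_c}(A_0 ∩ A_x)`, where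
`A_y = DCT16.armEvent y n = {y ↔ y + ∂Λ_n inside y + Λ_n}`: Harris's inequality for the two
increasing local events `A_0`, `A_x` (`harris_fkg_local`), translation invariance
`P(A_y) = P(0 ↔ ∂Λ_n)` (`DCT16.real_armEvent`), summed over `x ∈ Λ_n`. [folklore] -/
theorem stub_pairFKG :
    ∀ n : ℕ,
      ((box 3 n).card : ℝ) *
          (bondPercolation (zdGraph 3) (criticalProbI 3)).real (siteToBoundary 3 n) ^ 2 ≤
        ∑ x ∈ box 3 n, (bondPercolation (zdGraph 3) (criticalProbI 3)).real
          (DCT16.armEvent 0 n ∩ DCT16.armEvent x n) := by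
  intro n
  calc ((box 3 n).card : ℝ) *
          (bondPercolation (zdGraph 3) (criticalProbI 3)).real (siteToBoundary 3 n) ^ 2
      = ∑ _x ∈ box 3 n,
          (bondPercolation (zdGraph 3) (criticalProbI 3)).real (siteToBoundary 3 n) ^ 2 := by
        rw [Finset.sum_const, nsmul_eq_mul]
    _ ≤ ∑ x ∈ box 3 n, (bondPercolation (zdGraph 3) (criticalProbI 3)).real
          (DCT16.armEvent 0 n ∩ DCT16.armEvent x n) :=
        Finset.sum_le_sum fun x _ =>
          PairFKG.real_siteToBoundary_sq_le_real_armEvent_inter (criticalProbI 3) 0 x n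

end Summit.CriticalPhenomena.PercolationContinuityZ3.Theorems

end
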